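import Mathlib
import HarnessLib

/-!
# E-TAIL's dust clause, typed: the face `HasFatFastCore ρ V`, the class-free `RadialCapacity` lemma statement, the fat-core exclusion
# `FatCoreExclusion ρ` and the plate `FatCorePlate` (definitions only)

Sub-problem `NavierStokesRegularity`, crux `PowerGaugeEulerLiouville` (stmt-NavierStokesRegularity-19832; a crux CLASS of self-similar Euler/NS
strata on the MODEL lattice — not NS regularity).  Texts VERBATIM from nsreg-p2 g42 ROUND-52 «PROVENANCE» §D (v1.2 record, v1.3 addendum R2),
`r52/Sketch52.lean` sha16 99b21c971b35777c l.261 / l.271 / l.283 / l.292 (there in namespace `NsregP2.R52.Provenance`; here under the crux's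
Theorems namespace so that the plate t55-FAT `fatCorePlate : FatCorePlate`, the class-free lemma t55-RC `radialCapacity : RadialCapacity`
(ns-sfl-p1 lane) and the LEAD's member / `IsKinematicTameProfile` alternative «fat core» reference them BY NAME).

* `HasFatFastCore ρ V` — «cofinally in the radius some far point `y₀` carries a `b`-FAT FAST CORE: `‖V‖ ≥ c₂‖y₀‖` on `B̄(y₀, c₁‖y₀‖^{−(1+ρ)})`»;
  its NEGATION («DUST»: every far fast core is `o(b)`-thin in every direction) is the honest binder the needle keeps;
* `RadialCapacity` — if `‖V‖ ≥ m` on `B̄(y₀, ℓ)`, `0 < ℓ ≤ L/2`, then `∫_{B(y₀,L)} ‖DV‖² ≥ m²ℓ(π − vol{y ∈ B(y₀,L) : m/2 ≤ ‖V y‖}/L³)`;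
* `FatCoreExclusion ρ` — `V ∈ C¹` + weighted-energy finiteness + the A-gauge `∫_{B(0,R)}‖V‖² ≤ cR^{1−2ρ}` ⇒ `¬HasFatFastCore ρ V`;
* `FatCorePlate` — `∀ ρ ∈ (0,1), RadialCapacity → FatCoreExclusion ρ`.

Nothing is proved here; 19832 OPEN; NS regularity NOT proved.  [nsreg-p2 g42 ROUND-52 §D; folklore (radial length–energy)]
-/

noncomputable section

set_option linter.dupNamespace false

open Set Metric MeasureTheory Function
open scoped RealInnerProductSpace ENNReal NNReal

namespace Summit.NavierStokesRegularity.NavierStokesRegularity.Theorems.PowerGaugeEulerLiouville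

/-- **FACE «FAT CORE»** (alternative candidate, consumes exactly E-TAIL): cofinally in the radius there is a far point `y₀` carrying a `b`-FAT
FAST CORE — `‖V‖ ≥ c₂‖y₀‖` on the whole ball `B̄(y₀, c₁·‖y₀‖^{−(1+ρ)})` (`b(R) = R^{−(1+ρ)}` = the A-gauge transverse scale).  Its negation
(«DUST») is kept by the needle: every far fast core is `o(b)`-thin in every direction. [nsreg-p2 g42 ROUND-52 §D, r52/Sketch52.lean VERBATIM] -/
def HasFatFastCore (ρ : ℝ) (V : EuclideanSpace ℝ (Fin 3) → EuclideanSpace ℝ (Fin 3)) : Prop :=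
  ∃ c₁ : ℝ, 0 < c₁ ∧ ∃ c₂ : ℝ, 0 < c₂ ∧ ∀ R₀ : ℝ, ∃ y₀ : EuclideanSpace ℝ (Fin 3), R₀ ≤ ‖y₀‖ ∧
    ∀ y ∈ closedBall y₀ (c₁ * ‖y₀‖ ^ (-(1 + ρ))), c₂ * ‖y₀‖ ≤ ‖V y‖

/-- **RADIAL CAPACITY LEMMA** (statement; class-free, symmetrization-free; provable by polar coordinates about `y₀`): if `‖V‖ ≥ m` on
`B̄(y₀, ℓ)`, `0 < ℓ ≤ L/2`, then `∫_{B(y₀,L)} ‖DV‖² ≥ m²·ℓ·(π − vol{y ∈ B(y₀,L) : m/2 ≤ ‖V y‖}/L³)` — along each direction either `‖V‖ ≥ m/2`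
on `[ℓ, L)` (these directions fill volume `≥ |Θ_bad|·L³/4` of the level set) or `‖V‖` drops by `m/2` and Cauchy–Schwarz with `∫_ℓ^∞ dr/r² = 1/ℓ`
gives `∫_ℓ^L ‖DV(y₀+rθ)‖² r² dr ≥ m²ℓ/4`. [nsreg-p2 g42 ROUND-52 §D, r52/Sketch52.lean VERBATIM; folklore (radial length–energy)] -/
def RadialCapacity : Prop :=
  ∀ (V : EuclideanSpace ℝ (Fin 3) → EuclideanSpace ℝ (Fin 3)), ContDiff ℝ 1 V →
    ∀ (y₀ : EuclideanSpace ℝ (Fin 3)) (m ℓ L : ℝ), 0 < m → 0 < ℓ → 2 * ℓ ≤ L →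
    (∀ y ∈ closedBall y₀ ℓ, m ≤ ‖V y‖) →
      m ^ 2 * ℓ * (Real.pi - (volume {y ∈ ball y₀ L | m / 2 ≤ ‖V y‖}).toReal / L ^ 3) ≤
        ∫ y in ball y₀ L, ‖fderiv ℝ V y‖ ^ 2

/-- **THE FAT-CORE EXCLUSION, class-free**: `V ∈ C¹`, finite weighted energy `∫‖DV‖²‖y‖^{ρ−1} < ∞` and the A-gauge `∫_{B(0,R)}‖V‖² ≤ c·R^{1−2ρ}`
(`R > 0`; the tree's `NeedleThinCore.selfSimilar_shell_inputs` shape) exclude a cofinal `b`-fat fast core. [nsreg-p2 g42 ROUND-52 §D v1.3, VERBATIM] -/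
def FatCoreExclusion (ρ : ℝ) : Prop :=
  ∀ (V : EuclideanSpace ℝ (Fin 3) → EuclideanSpace ℝ (Fin 3)) (c : ℝ), ContDiff ℝ 1 V →
    (∫⁻ y, ‖fderiv ℝ V y‖ₑ ^ 2 * ENNReal.ofReal (‖y‖ ^ (ρ - 1))) ≠ ⊤ →
    (∀ R : ℝ, 0 < R → ∫⁻ y in ball (0 : EuclideanSpace ℝ (Fin 3)) R, ‖V y‖ₑ ^ 2 ≤ ENNReal.ofReal (c * R ^ (1 - 2 * ρ))) →
      ¬ HasFatFastCore ρ V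

/-- **Plate t55-FAT as one implication**: `RadialCapacity → FatCoreExclusion ρ` for `0 < ρ < 1`. [nsreg-p2 g42 ROUND-52 §D v1.3, VERBATIM] -/
def FatCorePlate : Prop := ∀ ρ : ℝ, 0 < ρ → ρ < 1 → RadialCapacity → FatCoreExclusion ρ

end Summit.NavierStokesRegularity.NavierStokesRegularity.Theorems.PowerGaugeEulerLiouville

end
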